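import Mathlib
import Summits.NavierStokesRegularity.NavierStokesRegularity.Theorems.ThreadingFluxHorizonTowerZonalAssembly
import Summits.NavierStokesRegularity.NavierStokesRegularity.Theorems.ThreadingFluxLoopLawBracketSlots
import Summits.NavierStokesRegularity.NavierStokesRegularity.Theorems.ThreadingFluxHorizonTowerNullConeChart
import HarnessLib

/-!
# Crux `PoloidalLiouville` (stmt-NavierStokesRegularity-1222), crux idea «horizon-threading-tower» (ns-idea-15):
# THE NULL-CONE CHART IS INJECTIVE ON HARMONICS

Support file (`--supports stmt-NavierStokesRegularity-1222`, helper; cell `ns-wall-extremal`, width hand ns-wall-eng-3 g4; 0 kit).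

★ `eq_zero_of_chartT_eq_zero`: a complex homogeneous polynomial `q` on `ℂ³` with flat Laplacian `lapP q = 0` whose isotropic chart
`chartT q` (`t ↦ q(1 − t², i(1 + t²), 2t)`, tree `Zonal.chartT`) vanishes is ZERO — a solid harmonic is determined by its restriction to
the null cone.  Proof (no Nullstellensatz): in the complex coordinates `(W, V, Z)` of ns-wall-eng-5 g4 (`Zonal.theta`) the chart is the
substitution `(W, V, Z) ↦ (−2t², 2, 2t)` (`chartT_eq_aeval_theta`); a monomial `WᵃVᵇZᶜ` of degree `n` and azimuthal weight `a − b`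
lands on `t^{n + (a−b)}`, so the weight-`μ` component of a degree-`n` polynomial contributes only to the coefficient of `t^{n+μ}`, with
value `2ⁿ Σ_d (−1)^{d₀} coeff_d` (`coeff_aevalW_of_isWeightedHomogeneous`); for a HARMONIC weight slot this alternating slot sum is a
POSITIVE multiple of the leading slot coefficient (the harmonic recursion `slot_recursion` of `…ZonalSlot` alternates signs), so it
vanishes only if the slot does (`eq_zero_of_harmonic_slot_sum`, both signs of the weight via the mirror `W ↔ V` and
`isWeightedHomogeneous_mirror` of `…LoopLawBracketSlots`); a top-weight descent
(`eq_zero_of_aevalW_eq_zero`) finishes.  Used by `…NullConeZonalAxis` / `…FiniteTowerDescent` to turn «the chart of the rotation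
derivative vanishes» into «the shell is zonal».

HONEST LABEL: linear algebra of solid harmonics about one crux idea's typed objects; no sketch Prop closed; `HorizonTowerZonality`
(general towers), `PoloidalLiouville` (1222) OPEN; NS regularity NOT proved.  [folklore]
-/

-- the summit and its single sub-problem share the name (CONVENTIONS §1)
set_option linter.dupNamespace false

noncomputable section

open MvPolynomial Complex Finsupp
open scoped Polynomial

namespace Summit.NavierStokesRegularity.NavierStokesRegularity.Theorems.PoloidalLiouville.HorizonTower.Zonal

/-! ### The chart in the complex coordinates `(W, V, Z)`: the substitution `(−2t², 2, 2t)` -/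

/-- In the coordinates `W = x₀ + i x₁`, `V = x₀ − i x₁`, `Z = x₂` the isotropic chart is the substitution
`(W, V, Z) ↦ (−2t², 2, 2t)`: `chartT q = (θ q)(−2t², 2, 2t)`. [folklore] -/
theorem chartT_eq_aeval_theta (q : MvPolynomial (Fin 3) ℂ) :
    chartT q = aeval ![-(2 * Polynomial.X ^ 2), (2 : ℂ[X]), 2 * Polynomial.X] (theta q) := by
  rw [theta, aeval_bind₁, chartT_eq_aeval]
  have h12 : Polynomial.C (1 / 2 : ℂ) * (2 : ℂ[X]) = 1 := by
    rw [show (2 : ℂ[X]) = Polynomial.C (2 : ℂ) from (Polynomial.C_ofNat 2).symm, ← Polynomial.C_mul, ← Polynomial.C_1]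
    congr 1; norm_num
  have hI2 : Polynomial.C (-I / 2) * (2 : ℂ[X]) = -Polynomial.C I := by
    rw [show (2 : ℂ[X]) = Polynomial.C (2 : ℂ) from (Polynomial.C_ofNat 2).symm, ← Polynomial.C_mul, ← Polynomial.C_neg]
    congr 1; ring
  have hv : (fun i : Fin 3 => aeval ![-(2 * Polynomial.X ^ 2), (2 : ℂ[X]), 2 * Polynomial.X] (thetaFun i))
      = ![(1 : Polynomial ℂ) - Polynomial.X ^ 2, Polynomial.C I * (1 + Polynomial.X ^ 2), 2 * Polynomial.X] := by
    funext i
    fin_cases i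
    · simp only [Fin.zero_eta, Matrix.cons_val_zero, thetaFun_zero, map_mul, aeval_C, Polynomial.algebraMap_eq, map_add,
        aeval_X, Matrix.cons_val_one]
      linear_combination (1 - Polynomial.X ^ 2) * h12
    · simp only [Fin.mk_one, Matrix.cons_val_one, Matrix.cons_val_zero, thetaFun_one, map_mul, aeval_C,
        Polynomial.algebraMap_eq, map_sub, aeval_X]
      linear_combination (-(1 + Polynomial.X ^ 2)) * hI2
    · simp only [Fin.reduceFinMk, Matrix.cons_val, thetaFun_two, aeval_X]
  rw [hv]

/-- A monomial `W^a V^b Z^c` under the `(W,V,Z)`-chart: `(−1)^a 2^{a+b+c} t^{2a+c}`. [folklore] -/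
theorem aevalW_monomial (d : Fin 3 →₀ ℕ) (c : ℂ) :
    aeval ![-(2 * Polynomial.X ^ 2), (2 : ℂ[X]), 2 * Polynomial.X] (monomial d c)
      = Polynomial.C (c * (-1) ^ (d 0) * 2 ^ (d 0 + d 1 + d 2)) * Polynomial.X ^ (2 * d 0 + d 2) := by
  rw [aeval_monomial, Finsupp.prod_fintype _ _ (fun i => by simp), Fin.prod_univ_three, Polynomial.algebraMap_eq]
  simp only [Matrix.cons_val_zero, Matrix.cons_val_one, Matrix.cons_val, map_mul, map_pow, map_neg, map_one,
    Polynomial.C_ofNat]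
  rw [neg_pow, mul_pow, mul_pow]
  ring

/-- Coefficients of the chart of a monomial. [folklore] -/
theorem coeff_aevalW_monomial (d : Fin 3 →₀ ℕ) (c : ℂ) (N : ℕ) :
    (aeval ![-(2 * Polynomial.X ^ 2), (2 : ℂ[X]), 2 * Polynomial.X] (monomial d c)).coeff N
      = if N = 2 * d 0 + d 2 then c * (-1) ^ (d 0) * 2 ^ (d 0 + d 1 + d 2) else 0 := by
  rw [aevalW_monomial, Polynomial.coeff_C_mul_X_pow]

/-! ### Coefficient bookkeeping by azimuthal weight -/

/-- **Weight bound ⇒ degree bound on the chart**: if every monomial of the degree-`n` polynomial `P` has weight `≤ β`, the chart of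
`P` has no coefficient beyond `t^{n+β}`. [folklore] -/
theorem coeff_aevalW_eq_zero_of_WB {P : CPoly} {β : ℤ} {n N : ℕ} (hP : WB β P) (hn : P.IsHomogeneous n)
    (hN : (n : ℤ) + β < N) : (aeval ![-(2 * Polynomial.X ^ 2), (2 : ℂ[X]), 2 * Polynomial.X] P).coeff N = 0 := by
  classical
  conv_lhs => rw [P.as_sum]
  rw [map_sum, Polynomial.finsetSum_coeff]
  refine Finset.sum_eq_zero fun d hd => ?_
  have hc : coeff d P ≠ 0 := MvPolynomial.mem_support_iff.mp hd
  have hw := hP d hc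
  rw [weight_wt] at hw
  have hdeg : d 0 + d 1 + d 2 = n := by rw [← weight_one_fin3]; exact hn hc
  rw [coeff_aevalW_monomial, if_neg]
  omega

/-- **The chart of a pure weight component is a monomial**: for `P` of weight `μ` and degree `n`, the coefficient of `t^{n+μ}` in the
chart of `P` is `2ⁿ Σ_{d ∈ supp P} (−1)^{d₀} coeff_d P`. [folklore] -/
theorem coeff_aevalW_of_isWeightedHomogeneous {P : CPoly} {μ : ℤ} {n N : ℕ} (hw : IsWeightedHomogeneous wt P μ)
    (hn : P.IsHomogeneous n) (hN : (N : ℤ) = n + μ) :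
    (aeval ![-(2 * Polynomial.X ^ 2), (2 : ℂ[X]), 2 * Polynomial.X] P).coeff N
      = 2 ^ n * ∑ d ∈ P.support, (-1) ^ (d 0) * coeff d P := by
  classical
  conv_lhs => rw [P.as_sum]
  rw [map_sum, Polynomial.finsetSum_coeff, Finset.mul_sum]
  refine Finset.sum_congr rfl fun d hd => ?_
  obtain ⟨h1, h2⟩ := exponent_of_mem_support hw hn hd
  rw [coeff_aevalW_monomial, if_pos (by omega), h2]
  ring

/-- The support of a weight-`M` slot (`M ≥ 0`), re-indexed by the slot index `k`:
`Σ_{d ∈ supp P} (−1)^{d₀} coeff_d P = (−1)^M Σ_k (−1)^k a_k`, `a_k = coeff (W^{M+k} V^k Z^{dd−2k}) P`. [folklore] -/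
theorem sum_support_eq_sum_sx {P : CPoly} {M dd : ℕ} (hw : IsWeightedHomogeneous wt P (M : ℤ))
    (hn : P.IsHomogeneous (M + dd)) :
    ∑ d ∈ P.support, (-1 : ℂ) ^ (d 0) * coeff d P
      = (-1) ^ M * ∑ k ∈ Finset.range (dd / 2 + 1), (-1) ^ k * coeff (sx M dd k) P := by
  classical
  have hinj : Set.InjOn (sx M dd) ↑(Finset.range (dd / 2 + 1)) := by
    intro k _ k' _ h
    have := congrArg (fun d : Fin 3 →₀ ℕ => d 1) h
    simpa using this
  have himage : ∑ d ∈ (Finset.range (dd / 2 + 1)).image (sx M dd), (-1 : ℂ) ^ (d 0) * coeff d P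
      = ∑ k ∈ Finset.range (dd / 2 + 1), (-1 : ℂ) ^ ((sx M dd k) 0) * coeff (sx M dd k) P :=
    Finset.sum_image hinj
  rw [Finset.mul_sum]
  have hrhs : ∑ k ∈ Finset.range (dd / 2 + 1), (-1 : ℂ) ^ M * ((-1) ^ k * coeff (sx M dd k) P)
      = ∑ k ∈ Finset.range (dd / 2 + 1), (-1 : ℂ) ^ ((sx M dd k) 0) * coeff (sx M dd k) P := by
    refine Finset.sum_congr rfl fun k _ => ?_
    rw [sx_zero, pow_add]; ring
  rw [hrhs, ← himage]
  apply Finset.sum_subset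
  · intro d hd
    obtain ⟨k, hk, rfl⟩ := exists_sx_of_mem_support hw hn hd
    exact Finset.mem_image.mpr ⟨k, Finset.mem_range.mpr (by omega), rfl⟩
  · intro d _ hd
    rw [MvPolynomial.notMem_support_iff.mp hd, mul_zero]

/-! ### Positivity of the alternating slot sum of a harmonic slot -/

/-- **The alternating slot sum detects the slot.**  For a harmonic weight-`M` slot (`Δ̃P = 0`) the harmonic recursion
`4(M+k+1)(k+1) a_{k+1} = −(dd−2k−1)(dd−2k) a_k` makes `(−1)^k a_k` a non-negative real multiple of `a₀`; hence
`Σ_k (−1)^k a_k = 0` forces `a₀ = 0`. [folklore] -/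
theorem coeff_sx_zero_eq_zero_of_alternating_sum {P : CPoly} {M dd : ℕ} (hn : P.IsHomogeneous (M + dd))
    (hlap : lapC P = 0) (hS : ∑ k ∈ Finset.range (dd / 2 + 1), (-1 : ℂ) ^ k * coeff (sx M dd k) P = 0) :
    coeff (sx M dd 0) P = 0 := by
  by_contra h0
  -- `(−1)^k a_k = t_k · a₀` with `t_k ≥ 0` real and `t₀ = 1`
  have hρ : ∀ k : ℕ, ∃ t : ℝ, 0 ≤ t ∧ (-1 : ℂ) ^ k * coeff (sx M dd k) P = (t : ℂ) * coeff (sx M dd 0) P ∧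
      (k = 0 → t = 1) := by
    intro k
    induction k with
    | zero => exact ⟨1, zero_le_one, by simp, fun _ => rfl⟩
    | succ k ih =>
      obtain ⟨t, ht0, ht, -⟩ := ih
      by_cases hk : 2 * k + 2 ≤ dd
      · have hrec := slot_recursion (M := M) (dd := dd) hlap hk
        have hne : (4 * (((M : ℂ) + k) + 1) * ((k : ℂ) + 1)) ≠ 0 := by
          have h1 : ((M : ℂ) + k) + 1 ≠ 0 := by exact_mod_cast (Nat.succ_ne_zero (M + k))
          have h2 : (k : ℂ) + 1 ≠ 0 := by exact_mod_cast (Nat.succ_ne_zero k)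
          simp [h1, h2]
        refine ⟨t * ((((dd : ℝ) - 2 * k) - 1) * ((dd : ℝ) - 2 * k) / (4 * (((M : ℝ) + k) + 1) * ((k : ℝ) + 1))), ?_, ?_,
          fun h => absurd h (Nat.succ_ne_zero k)⟩
        · have hk' : (2 * k + 2 : ℝ) ≤ dd := by exact_mod_cast hk
          refine mul_nonneg ht0 (div_nonneg (mul_nonneg (by linarith) (by linarith)) ?_)
          positivity
        · have heq : (-1 : ℂ) ^ (k + 1) * coeff (sx M dd (k + 1)) P * (4 * (((M : ℂ) + k) + 1) * ((k : ℂ) + 1))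
              = (t : ℂ) * coeff (sx M dd 0) P * ((((dd : ℂ) - 2 * k) - 1) * ((dd : ℂ) - 2 * k)) := by
            rw [pow_succ]
            linear_combination (-(-1 : ℂ) ^ k) * hrec + ((((dd : ℂ) - 2 * k) - 1) * ((dd : ℂ) - 2 * k)) * ht
          push_cast
          rw [show (t : ℂ) * ((((dd : ℂ) - 2 * k) - 1) * ((dd : ℂ) - 2 * k) / (4 * (((M : ℂ) + k) + 1) * ((k : ℂ) + 1)))
              * coeff (sx M dd 0) P
              = (t : ℂ) * coeff (sx M dd 0) P * ((((dd : ℂ) - 2 * k) - 1) * ((dd : ℂ) - 2 * k))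
                / (4 * (((M : ℂ) + k) + 1) * ((k : ℂ) + 1)) by ring, eq_div_iff hne, heq]
      · have hz : coeff (sx M dd (k + 1)) P = 0 := coeff_sx_eq_zero_of_lt hn (by omega)
        exact ⟨0, le_rfl, by simp [hz], fun h => absurd h (Nat.succ_ne_zero k)⟩
  choose t ht0 ht h1 using hρ
  have hsum : ∑ k ∈ Finset.range (dd / 2 + 1), (-1 : ℂ) ^ k * coeff (sx M dd k) P
      = ((∑ k ∈ Finset.range (dd / 2 + 1), t k : ℝ) : ℂ) * coeff (sx M dd 0) P := by
    push_cast
    rw [Finset.sum_mul]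
    exact Finset.sum_congr rfl fun k _ => ht k
  have hpos : 0 < ∑ k ∈ Finset.range (dd / 2 + 1), t k := by
    calc (0 : ℝ) < t 0 := by rw [h1 0 rfl]; exact one_pos
      _ ≤ ∑ k ∈ Finset.range (dd / 2 + 1), t k :=
        Finset.single_le_sum (f := t) (fun k _ => ht0 k) (Finset.mem_range.mpr (Nat.succ_pos _))
  have hne : ((∑ k ∈ Finset.range (dd / 2 + 1), t k : ℝ) : ℂ) * coeff (sx M dd 0) P ≠ 0 :=
    mul_ne_zero (by exact_mod_cast hpos.ne') h0
  exact hne (hsum ▸ hS)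

/-- ★ **A harmonic weight component with vanishing alternating slot sum is zero** (both signs of the weight). [folklore] -/
theorem eq_zero_of_harmonic_slot_sum {P : CPoly} {μ : ℤ} {n : ℕ} (hw : IsWeightedHomogeneous wt P μ)
    (hn : P.IsHomogeneous n) (hlap : lapC P = 0) (hS : ∑ d ∈ P.support, (-1 : ℂ) ^ (d 0) * coeff d P = 0) :
    P = 0 := by
  classical
  by_contra hP
  obtain ⟨d₀, hd₀⟩ := exists_coeff_ne_zero hP
  obtain ⟨hμ, hdeg⟩ := exponent_of_mem_support hw hn (MvPolynomial.mem_support_iff.mpr hd₀)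
  rcases le_or_gt 0 μ with hpos | hneg
  · -- weight `M ≥ 0`: the slot machinery applies directly
    obtain ⟨M, rfl⟩ := Int.eq_ofNat_of_zero_le hpos
    have hMn : M ≤ n := by omega
    obtain ⟨dd, rfl⟩ := Nat.exists_eq_add_of_le hMn
    rw [sum_support_eq_sum_sx hw hn] at hS
    have hS' : ∑ k ∈ Finset.range (dd / 2 + 1), (-1 : ℂ) ^ k * coeff (sx M dd k) P = 0 :=
      (mul_eq_zero.mp hS).resolve_left (pow_ne_zero _ (by norm_num))
    exact hP (slot_eq_zero_of_coeff_zero hw hn hlap (coeff_sx_zero_eq_zero_of_alternating_sum hn hlap hS'))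
  · -- weight `−M < 0`: pass to the mirror image, a weight-`M` slot
    obtain ⟨M, hM⟩ := Int.eq_ofNat_of_zero_le (by omega : 0 ≤ -μ)
    set Q : CPoly := mirror P with hQ
    have hQw : IsWeightedHomogeneous wt Q (M : ℤ) := by rw [← hM]; exact isWeightedHomogeneous_mirror hw
    have hQn : Q.IsHomogeneous n := hn.rename_isHomogeneous
    have hQlap : lapC Q = 0 := by rw [hQ, mirror_lapC, hlap, map_zero]
    have hMn : M ≤ n := by omega
    obtain ⟨dd, rfl⟩ := Nat.exists_eq_add_of_le hMn
    -- the alternating sum of `Q` is `(−1)^M` times that of `P`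
    have hinj : Function.Injective (Finsupp.mapDomain (Equiv.swap (0 : Fin 3) 1) : (Fin 3 →₀ ℕ) → (Fin 3 →₀ ℕ)) :=
      Finsupp.mapDomain_injective (Equiv.swap (0 : Fin 3) 1).injective
    have hsuppQ : Q.support = P.support.image (Finsupp.mapDomain (Equiv.swap (0 : Fin 3) 1)) :=
      support_rename_of_injective (Equiv.swap (0 : Fin 3) 1).injective
    have hSQ : ∑ e ∈ Q.support, (-1 : ℂ) ^ (e 0) * coeff e Q = (-1) ^ M * ∑ d ∈ P.support, (-1 : ℂ) ^ (d 0) * coeff d P := by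
      rw [hsuppQ, Finset.sum_image (hinj.injOn), Finset.mul_sum]
      refine Finset.sum_congr rfl fun d hd => ?_
      obtain ⟨h1, -⟩ := exponent_of_mem_support hw hn hd
      have e0 : (d.mapDomain (Equiv.swap (0 : Fin 3) 1)) 0 = d 1 := by
        have h := Finsupp.mapDomain_apply (Equiv.swap (0 : Fin 3) 1).injective d 1
        rwa [Equiv.swap_apply_right] at h
      rw [hQ, coeff_mirror, e0]
      have hd1 : d 1 = d 0 + M := by omega
      rw [hd1, pow_add]; ring
    rw [hS, mul_zero] at hSQ
    rw [sum_support_eq_sum_sx hQw hQn] at hSQ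
    have hS' : ∑ k ∈ Finset.range (dd / 2 + 1), (-1 : ℂ) ^ k * coeff (sx M dd k) Q = 0 :=
      (mul_eq_zero.mp hSQ).resolve_left (pow_ne_zero _ (by norm_num))
    have hQ0 : Q = 0 := slot_eq_zero_of_coeff_zero hQw hQn hQlap (coeff_sx_zero_eq_zero_of_alternating_sum hQn hQlap hS')
    exact hP (rename_injective _ (Equiv.swap (0 : Fin 3) 1).injective (by rw [map_zero]; exact hQ0))

/-! ### ★ Injectivity of the chart on solid harmonics -/

/-- Top-weight descent: a degree-`n` polynomial in `(W,V,Z)` with `Δ̃P = 0`, all weights `≤ β`, and vanishing chart is zero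
(induction on `β + n`). [folklore] -/
theorem eq_zero_of_aevalW_eq_zero_aux (n m : ℕ) : ∀ (P : CPoly) (β : ℤ), P.IsHomogeneous n → lapC P = 0 → WB β P →
    β + n < m → aeval ![-(2 * Polynomial.X ^ 2), (2 : ℂ[X]), 2 * Polynomial.X] P = 0 → P = 0 := by
  classical
  induction m with
  | zero =>
    intro P β hn _ hB hm _
    by_contra hP
    obtain ⟨d, hd⟩ := exists_coeff_ne_zero hP
    have hw := hB d hd
    rw [weight_wt] at hw
    have hdeg : d 0 + d 1 + d 2 = n := by rw [← weight_one_fin3]; exact hn hd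
    omega
  | succ m ih =>
    intro P β hn hlap hB hm h0
    set Pb : CPoly := weightedHomogeneousComponent wt β P with hPb
    have hPbw : IsWeightedHomogeneous wt Pb β := weightedHomogeneousComponent_isWeightedHomogeneous β P
    have hPbn : Pb.IsHomogeneous n := isHomogeneous_wcomp hn β
    have hPblap : lapC Pb = 0 := by rw [hPb, ← wcomp_lapC, hlap, map_zero]
    have hrest : WB (β - 1) (P - Pb) := hB.sub_wcomp
    have hrestn : (P - Pb).IsHomogeneous n := hn.sub hPbn
    -- the top component vanishes
    have hPb0 : Pb = 0 := by
      by_cases hnb : (n : ℤ) + β < 0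
      · by_contra hne
        obtain ⟨d, hd⟩ := exists_coeff_ne_zero hne
        obtain ⟨h1, h2⟩ := exponent_of_mem_support hPbw hPbn (MvPolynomial.mem_support_iff.mpr hd)
        omega
      · set N : ℕ := ((n : ℤ) + β).toNat with hN
        have hNeq : (N : ℤ) = n + β := Int.toNat_of_nonneg (by omega)
        have hc : (aeval ![-(2 * Polynomial.X ^ 2), (2 : ℂ[X]), 2 * Polynomial.X] P).coeff N = 0 := by
          rw [h0, Polynomial.coeff_zero]
        have hsplit : P = Pb + (P - Pb) := by ring
        rw [hsplit, map_add, Polynomial.coeff_add, coeff_aevalW_eq_zero_of_WB hrest hrestn (by omega), add_zero,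
          coeff_aevalW_of_isWeightedHomogeneous hPbw hPbn hNeq] at hc
        have hS : ∑ d ∈ Pb.support, (-1 : ℂ) ^ (d 0) * coeff d Pb = 0 :=
          (mul_eq_zero.mp hc).resolve_left (pow_ne_zero _ two_ne_zero)
        exact eq_zero_of_harmonic_slot_sum hPbw hPbn hPblap hS
    have hP' : P - Pb = P := by rw [hPb0, sub_zero]
    rw [← hP']
    exact ih (P - Pb) (β - 1) hrestn (by rw [hP']; exact hlap) hrest (by omega) (by rw [hP']; exact h0)

/-- Every polynomial has a weight bound (its degree). [folklore] -/
theorem WB_of_isHomogeneous {P : CPoly} {n : ℕ} (hn : P.IsHomogeneous n) : WB (n : ℤ) P := by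
  intro d hd
  rw [weight_wt]
  have hdeg : d 0 + d 1 + d 2 = n := by rw [← weight_one_fin3]; exact hn hd
  omega

/-- ★★ **THE NULL-CONE CHART IS INJECTIVE ON SOLID HARMONICS**: a complex homogeneous polynomial `q` on `ℂ³` with flat Laplacian
`lapP q = 0` and vanishing isotropic chart `chartT q = 0` is zero. [folklore] -/
theorem eq_zero_of_chartT_eq_zero {q : MvPolynomial (Fin 3) ℂ} {n : ℕ} (hq : q.IsHomogeneous n) (hlap : lapP q = 0)
    (h0 : chartT q = 0) : q = 0 := by
  have hP : theta q = 0 := by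
    refine eq_zero_of_aevalW_eq_zero_aux n ((n : ℤ) + n + 1).toNat (theta q) n (isHomogeneous_theta hq) ?_
      (WB_of_isHomogeneous (isHomogeneous_theta hq)) (by omega) ?_
    · rw [lapC_theta, hlap, map_zero]
    · rw [← chartT_eq_aeval_theta]; exact h0
  exact eq_of_theta_eq q 0 (by rw [hP, map_zero])

/-- Real form: a real solid harmonic (homogeneous, `lapP q = 0`) whose complexification has vanishing chart is zero. [folklore] -/
theorem eq_zero_of_chartT_map_eq_zero {q : MvPolynomial (Fin 3) ℝ} {n : ℕ} (hq : q.IsHomogeneous n) (hlap : lapP q = 0)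
    (h0 : chartT (map (algebraMap ℝ ℂ) q) = 0) : q = 0 := by
  have h := eq_zero_of_chartT_eq_zero (hq.map _) (by rw [← map_lapP, hlap, map_zero]) h0
  exact (map_injective (algebraMap ℝ ℂ) (RCLike.ofReal_injective)) (by rw [h, map_zero])

end Summit.NavierStokesRegularity.NavierStokesRegularity.Theorems.PoloidalLiouville.HorizonTower.Zonal

end
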